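import Summits.ValiantsHypothesis.ValiantsHypothesis.Theorems.LacunarySymmetroidMatrixDescartesCensusDoorA34SquareLawSeparated

/-!
# `MatrixDescartes` census — the FIVE-LETTER SQUARE LAW on separated supports: deficiency TWO (`≤ 12` of Descartes `14`)

HONEST FRAMING.  Object-search cell `pub-symmetroid`, door-A seat `val-sym-door-p3` (g22); helper beside the OPEN item stmt-ValiantsHypothesis-19980
`DoorA34 = PosRootLawAt 3 4 18` (asserted nowhere).  A sector law of the five-letter symmetric formats (the sector's own Descartes bound is `14`); nothing here
bounds `ζ_sym(3,4)` or `ζ_sym(2,5)`; nothing bears on `MatrixDescartes` (stmt-ValiantsHypothesis-18050) or `VP ≠ VNP`.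

CONTENT.  Third rung of the SQUARE LAW ladder (`…CensusDoorA34SquareLaw`: three letters, `≤ 4` of `5`; `…SquareLawSeparated`: four letters, `≤ 8` of `9`):
on a five-letter SEPARATED alphabet `(0, a, a+b, a+b+c, a+b+c+e)` with `a ≤ b`, `a+b ≤ c`, `a+b+c ≤ e` (each exponent at least twice the previous one) the
square object `L² + M` (`L, M` in the span of the alphabet; the determinant of the unit hollow-cross symmetric `3 × 3` five-letter pencil, and minus the
determinant of the `2 × 2` five-letter pencil `[[−1, L], [L, M]]`) has AT MOST TWELVE distinct positive roots — TWO below the Descartes bound `14` of its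
fifteen monomials (`card_posRoots_sq_add_le_twelve`).  Proof: ELEVEN Euler twists (the five alphabet exponents and the six cross exponents) and the forced
sign pattern `(≤0, ≤0, ≥0, ≥0)` of the surviving pure-square form, which has at most one positive root by the four-term sign-cut lemma
`card_posRoots_le_one_of_signCut4` (one sign change ⇒ at most one positive root, by an exact two-root elimination).  General `K` (paper, report
HOME/DOOR-A34-P3G22-REPORT.md §2): `Z₊(L²+M) ≤ D − ⌈(K−2)/2⌉` on separated supports.

[folklore] Rolle's theorem in a Descartes system (twisted Rolle, tree `Census.card_posRoots_le_card_posRoots_twists`), elementary sign analysis.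
-/

-- `Summit.ValiantsHypothesis.ValiantsHypothesis.…` repeats a component by the D-0017 layout
-- (single-conjunct summit), which the `dupNamespace` linter flags; the name is mandated.
set_option linter.dupNamespace false

namespace Summit.ValiantsHypothesis.ValiantsHypothesis.Theorems.LacunarySymmetroidMatrixDescartes.Census.SquareLaw

open Polynomial Finset
open scoped BigOperators Polynomial

/-! ## 1. Four terms with one sign change have at most one positive root -/

/-- **Sign-cut lemma, four terms.**  If `A₁, A₂ ≤ 0 ≤ C₄` (ANY third coefficient `C₃`) then `A₁X^{i} + A₂X^{i+p} + C₃X^{i+p+q} + C₄X^{i+p+q+r}` (`p, q, r ≥ 1`) has at most ONE distinct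
positive root: for two roots `y₁ < y₂` the identity `Σ_t c_t (y₁^{e₃} y₂^{e_t} − y₂^{e₃} y₁^{e_t}) = y₁^{e₃}f(y₂) − y₂^{e₃}f(y₁) = 0` has every summand
`≥ 0` (the `C₃` terms cancel), forcing `A₁ = A₂ = C₄ = 0`, then `C₃ = 0`, and the zero polynomial has no roots. [folklore] -/
theorem card_posRoots_le_one_of_signCut4 (i p q r : ℕ) (hp : 0 < p) (hq : 0 < q) (hr : 0 < r) (A₁ A₂ C₃ C₄ : ℝ)
    (h₁ : A₁ ≤ 0) (h₂ : A₂ ≤ 0) (h₄ : 0 ≤ C₄) :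
    ((C A₁ * X ^ i + C A₂ * X ^ (i + p) + C C₃ * X ^ (i + p + q) + C C₄ * X ^ (i + p + q + r)).roots.toFinset.filter
      (fun x => 0 < x)).card ≤ 1 := by
  by_contra h
  push Not at h
  obtain ⟨x₁, hx₁, x₂, hx₂, hne⟩ := Finset.one_lt_card.mp h
  simp only [Finset.mem_filter, Multiset.mem_toFinset] at hx₁ hx₂
  set f := C A₁ * X ^ i + C A₂ * X ^ (i + p) + C C₃ * X ^ (i + p + q) + C C₄ * X ^ (i + p + q + r) with hf
  have hp0 : f ≠ 0 := fun h0 => by rw [h0, roots_zero] at hx₁; simp at hx₁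
  have root_eq : ∀ x : ℝ, 0 < x → x ∈ f.roots →
      A₁ + A₂ * x ^ p + C₃ * (x ^ p * x ^ q) + C₄ * (x ^ p * x ^ q * x ^ r) = 0 := by
    intro x hx hmem
    have hroot := (mem_roots hp0).mp hmem
    have ev : f.eval x = x ^ i * (A₁ + A₂ * x ^ p + C₃ * (x ^ p * x ^ q) + C₄ * (x ^ p * x ^ q * x ^ r)) := by
      simp only [hf, eval_add, eval_mul, eval_C, eval_pow, eval_X]; ring1
    have h1 : x ^ i * (A₁ + A₂ * x ^ p + C₃ * (x ^ p * x ^ q) + C₄ * (x ^ p * x ^ q * x ^ r)) = 0 := by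
      rw [← ev]; exact hroot
    rcases mul_eq_zero.mp h1 with h2 | h2
    · exact absurd h2 (pow_ne_zero _ hx.ne')
    · exact h2
  have main : ∀ y₁ y₂ : ℝ, 0 < y₁ → y₁ < y₂ →
      A₁ + A₂ * y₁ ^ p + C₃ * (y₁ ^ p * y₁ ^ q) + C₄ * (y₁ ^ p * y₁ ^ q * y₁ ^ r) = 0 →
      A₁ + A₂ * y₂ ^ p + C₃ * (y₂ ^ p * y₂ ^ q) + C₄ * (y₂ ^ p * y₂ ^ q * y₂ ^ r) = 0 → False := by
    intro y₁ y₂ hy₁ hlt e₁ e₂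
    have hy₂ : 0 < y₂ := hy₁.trans hlt
    -- divide conceptually by y^{p+q}: compare via the cross identity
    have key : A₁ * (y₂ ^ p * y₂ ^ q - y₁ ^ p * y₁ ^ q) + A₂ * (y₁ ^ p * y₂ ^ p) * (y₂ ^ q - y₁ ^ q)
        = C₄ * (y₁ ^ p * y₁ ^ q) * (y₂ ^ p * y₂ ^ q) * (y₂ ^ r - y₁ ^ r) := by
      linear_combination (y₂ ^ p * y₂ ^ q) * e₁ - (y₁ ^ p * y₁ ^ q) * e₂
    have hpq1 : 0 < y₂ ^ p * y₂ ^ q - y₁ ^ p * y₁ ^ q := by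
      have := mul_lt_mul'' (pow_lt_pow_left₀ hlt hy₁.le hp.ne') (pow_lt_pow_left₀ hlt hy₁.le hq.ne')
        (pow_pos hy₁ p).le (pow_pos hy₁ q).le
      linarith
    have hq1 : 0 < y₂ ^ q - y₁ ^ q := sub_pos.mpr (pow_lt_pow_left₀ hlt hy₁.le hq.ne')
    have hr1 : 0 < y₂ ^ r - y₁ ^ r := sub_pos.mpr (pow_lt_pow_left₀ hlt hy₁.le hr.ne')
    have hpp : 0 < y₁ ^ p * y₂ ^ p := mul_pos (pow_pos hy₁ p) (pow_pos hy₂ p)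
    have hP1 : 0 < y₁ ^ p * y₁ ^ q := mul_pos (pow_pos hy₁ p) (pow_pos hy₁ q)
    have hP2 : 0 < y₂ ^ p * y₂ ^ q := mul_pos (pow_pos hy₂ p) (pow_pos hy₂ q)
    have hL1 : A₁ * (y₂ ^ p * y₂ ^ q - y₁ ^ p * y₁ ^ q) ≤ 0 := mul_nonpos_of_nonpos_of_nonneg h₁ hpq1.le
    have hL2 : A₂ * (y₁ ^ p * y₂ ^ p) * (y₂ ^ q - y₁ ^ q) ≤ 0 :=
      mul_nonpos_of_nonpos_of_nonneg (mul_nonpos_of_nonpos_of_nonneg h₂ hpp.le) hq1.le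
    have hR : 0 ≤ C₄ * (y₁ ^ p * y₁ ^ q) * (y₂ ^ p * y₂ ^ q) * (y₂ ^ r - y₁ ^ r) := by positivity
    have hA1 : A₁ = 0 := by
      have h0 : A₁ * (y₂ ^ p * y₂ ^ q - y₁ ^ p * y₁ ^ q) = 0 := by linarith
      rcases mul_eq_zero.mp h0 with h' | h'
      · exact h'
      · exact absurd h' hpq1.ne'
    have hA2 : A₂ = 0 := by
      have h0 : A₂ * (y₁ ^ p * y₂ ^ p) * (y₂ ^ q - y₁ ^ q) = 0 := by linarith
      rcases mul_eq_zero.mp h0 with h' | h'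
      · rcases mul_eq_zero.mp h' with h'' | h''
        · exact h''
        · exact absurd h'' hpp.ne'
      · exact absurd h' hq1.ne'
    have hC4 : C₄ = 0 := by
      have h0 : C₄ * (y₁ ^ p * y₁ ^ q) * (y₂ ^ p * y₂ ^ q) * (y₂ ^ r - y₁ ^ r) = 0 := by
        rw [← key, hA1, hA2]; ring1
      rcases mul_eq_zero.mp h0 with h' | h'
      · rcases mul_eq_zero.mp h' with h'' | h''
        · rcases mul_eq_zero.mp h'' with h3 | h3
          · exact h3
          · exact absurd h3 hP1.ne'
        · exact absurd h'' hP2.ne'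
      · exact absurd h' hr1.ne'
    have hC3 : C₃ = 0 := by
      have h0 : C₃ * (y₁ ^ p * y₁ ^ q) = 0 := by
        have := e₁; rw [hA1, hA2, hC4] at this; linarith
      rcases mul_eq_zero.mp h0 with h' | h'
      · exact h'
      · exact absurd h' hP1.ne'
    apply hp0
    rw [hf, hA1, hA2, hC3, hC4]
    simp
  obtain ⟨hr₁, hpos₁⟩ := hx₁
  obtain ⟨hr₂, hpos₂⟩ := hx₂
  rcases lt_or_gt_of_ne hne with hlt | hlt
  · exact main x₁ x₂ hpos₁ hlt (root_eq x₁ hpos₁ hr₁) (root_eq x₂ hpos₂ hr₂)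
  · exact main x₂ x₁ hpos₂ hlt (root_eq x₂ hpos₂ hr₂) (root_eq x₁ hpos₁ hr₁)

/-! ## 2. The five-letter square object as a fifteen-term fewnomial -/

/-- Expansion of `L² + M` on the alphabet `(0, a, a+b, a+b+c, a+b+c+e)`; exponent order of the table:
alphabet `0, a, a+b, a+b+c, a+b+c+e`; cross `2a+b, 2a+b+c, 2a+b+c+e, 2a+2b+c, 2a+2b+c+e, 2a+2b+2c+e`; pure `2a, 2a+2b, 2a+2b+2c, 2a+2b+2c+2e`. [folklore] -/
theorem sq_add_eq_sum5 (a b c e : ℕ) (w u₁ u₂ u₃ u₄ m₀ m₁ m₂ m₃ m₄ : ℝ) :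
    (C w + C u₁ * X ^ a + C u₂ * X ^ (a + b) + C u₃ * X ^ (a + b + c) + C u₄ * X ^ (a + b + c + e)) ^ 2
        + (C m₀ + C m₁ * X ^ a + C m₂ * X ^ (a + b) + C m₃ * X ^ (a + b + c) + C m₄ * X ^ (a + b + c + e))
      = ∑ t : Fin 15, C ((![w ^ 2 + m₀, 2 * u₁ * w + m₁, 2 * u₂ * w + m₂, 2 * u₃ * w + m₃, 2 * u₄ * w + m₄,
            2 * u₁ * u₂, 2 * u₁ * u₃, 2 * u₁ * u₄, 2 * u₂ * u₃, 2 * u₂ * u₄, 2 * u₃ * u₄,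
            u₁ ^ 2, u₂ ^ 2, u₃ ^ 2, u₄ ^ 2] : Fin 15 → ℝ) t)
          * X ^ ((![0, a, a + b, a + b + c, a + b + c + e,
            2 * a + b, 2 * a + b + c, 2 * a + b + c + e, 2 * a + 2 * b + c, 2 * a + 2 * b + c + e, 2 * a + 2 * b + 2 * c + e,
            2 * a, 2 * a + 2 * b, 2 * a + 2 * b + 2 * c, 2 * a + 2 * b + 2 * c + 2 * e] : Fin 15 → ℕ) t) := by
  simp only [Fin.sum_univ_succ, Fin.sum_univ_zero, Matrix.cons_val_zero, Matrix.cons_val_succ,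
    map_add, map_mul, map_pow, map_ofNat, pow_zero, mul_one, add_zero]
  ring1

/-! ## 3. THE FIVE-LETTER SQUARE LAW on separated supports -/

set_option maxRecDepth 8000 in
set_option maxHeartbeats 1600000 in
/-- **FIVE-LETTER SQUARE LAW (separated supports): deficiency two.**  On the alphabet `1, X^a, X^{a+b}, X^{a+b+c}, X^{a+b+c+e}` with `0 < a ≤ b`,
`a + b ≤ c`, `a + b + c ≤ e`, for all real letters, `L² + M` (fifteen monomials, Descartes bound `14`) has AT MOST TWELVE distinct positive roots.
Eleven twists (alphabet + cross exponents) leave the pure-square form `A₁X^{2a} + A₂X^{2a+2b} + C₃X^{2a+2b+2c} + C₄X^{2a+2b+2c+2e}` with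
`A₁ = −u₁²·2a²(b−a)(b+c−a)(b+c+e−a)·b(b+c)·(b+c+e)(2b+c)·(2b+c+e)(2b+2c+e) ≤ 0`, `A₂ ≤ 0`, `C₄ ≥ 0` (and `C₃ ≥ 0`: one sign change; the sign of `C₃` is not even needed). [folklore] -/
theorem card_posRoots_sq_add_le_twelve (a b c e : ℕ) (ha : 0 < a) (hab : a ≤ b) (habc : a + b ≤ c) (habce : a + b + c ≤ e)
    (w u₁ u₂ u₃ u₄ m₀ m₁ m₂ m₃ m₄ : ℝ) :
    ((((C w + C u₁ * X ^ a + C u₂ * X ^ (a + b) + C u₃ * X ^ (a + b + c) + C u₄ * X ^ (a + b + c + e)) ^ 2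
        + (C m₀ + C m₁ * X ^ a + C m₂ * X ^ (a + b) + C m₃ * X ^ (a + b + c) + C m₄ * X ^ (a + b + c + e))).roots.toFinset.filter
      (fun x => 0 < x)).card) ≤ 12 := by
  rw [sq_add_eq_sum5]
  set ex : Fin 15 → ℕ := ![0, a, a + b, a + b + c, a + b + c + e,
            2 * a + b, 2 * a + b + c, 2 * a + b + c + e, 2 * a + 2 * b + c, 2 * a + 2 * b + c + e, 2 * a + 2 * b + 2 * c + e,
            2 * a, 2 * a + 2 * b, 2 * a + 2 * b + 2 * c, 2 * a + 2 * b + 2 * c + 2 * e] with hex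
  set cf : Fin 15 → ℝ := ![w ^ 2 + m₀, 2 * u₁ * w + m₁, 2 * u₂ * w + m₂, 2 * u₃ * w + m₃, 2 * u₄ * w + m₄,
            2 * u₁ * u₂, 2 * u₁ * u₃, 2 * u₁ * u₄, 2 * u₂ * u₃, 2 * u₂ * u₄, 2 * u₃ * u₄,
            u₁ ^ 2, u₂ ^ 2, u₃ ^ 2, u₄ ^ 2] with hcf
  have step := Census.card_posRoots_le_card_posRoots_twists ex cf ({0, 1, 2, 3, 4, 5, 6, 7, 8, 9, 10} : Finset (Fin 15))
  have hU : ({0, 1, 2, 3, 4, 5, 6, 7, 8, 9, 10} : Finset (Fin 15)).card = 11 := by decide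
  rw [hU] at step
  -- real abbreviations of the gaps
  have ha' : (0 : ℝ) < a := by exact_mod_cast ha
  have hab' : (a : ℝ) ≤ b := by exact_mod_cast hab
  have habc' : (a : ℝ) + b ≤ c := by exact_mod_cast habc
  have habce' : (a : ℝ) + b + c ≤ e := by exact_mod_cast habce
  have hb0 : (0 : ℝ) ≤ b := by positivity
  have hc0 : (0 : ℝ) ≤ c := by positivity
  have he0 : (0 : ℝ) ≤ e := by positivity
  set A₁ : ℝ := -(u₁ ^ 2 * (2 * (a : ℝ) * a) * (((b : ℝ) - a) * (((b : ℝ) + c - a) * ((b : ℝ) + c + e - a)))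
      * ((b : ℝ) * ((b : ℝ) + c) * ((b : ℝ) + c + e)) * ((2 * (b : ℝ) + c) * (2 * (b : ℝ) + c + e) * (2 * (b : ℝ) + 2 * c + e))) with hA₁
  set A₂ : ℝ := -(u₂ ^ 2 * ((2 * (a : ℝ) + 2 * b) * ((a : ℝ) + 2 * b) * ((a : ℝ) + b) * b)
      * (((c : ℝ) - a - b) * ((c : ℝ) + e - a - b)) * (((c : ℝ) - b) * ((c : ℝ) + e - b)) * ((c : ℝ) * ((c : ℝ) + e) * (2 * (c : ℝ) + e))) with hA₂
  set C₃ : ℝ := u₃ ^ 2 * ((2 * (a : ℝ) + 2 * b + 2 * c) * ((a : ℝ) + 2 * b + 2 * c) * ((a : ℝ) + b + 2 * c) * ((a : ℝ) + b + c)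
      * ((b : ℝ) + 2 * c) * ((b : ℝ) + c) * (c : ℝ))
      * (((e : ℝ) - a - b - c) * ((e : ℝ) - b - c) * ((e : ℝ) - c) * e) with hC₃
  set C₄ : ℝ := u₄ ^ 2 * ((2 * ((a : ℝ) + b + c + e)) * ((a : ℝ) + 2 * b + 2 * c + 2 * e) * ((a : ℝ) + b + 2 * c + 2 * e)
      * ((a : ℝ) + b + c + 2 * e) * ((a : ℝ) + b + c + e) * ((b : ℝ) + 2 * c + 2 * e) * ((b : ℝ) + c + 2 * e) * ((b : ℝ) + c + e)
      * ((c : ℝ) + 2 * e) * ((c : ℝ) + e) * (e : ℝ)) with hC₄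
  have hprod : ∀ t : Fin 15, ∏ u' ∈ ({0, 1, 2, 3, 4, 5, 6, 7, 8, 9, 10} : Finset (Fin 15)), ((ex t : ℝ) - ex u')
      = ((ex t : ℝ) - ex 0) * (((ex t : ℝ) - ex 1) * (((ex t : ℝ) - ex 2) * (((ex t : ℝ) - ex 3) * (((ex t : ℝ) - ex 4)
        * (((ex t : ℝ) - ex 5) * (((ex t : ℝ) - ex 6) * (((ex t : ℝ) - ex 7) * (((ex t : ℝ) - ex 8) * (((ex t : ℝ) - ex 9)
        * ((ex t : ℝ) - ex 10)))))))))) := by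
    intro t
    rw [Finset.prod_insert (by decide), Finset.prod_insert (by decide), Finset.prod_insert (by decide),
      Finset.prod_insert (by decide), Finset.prod_insert (by decide), Finset.prod_insert (by decide),
      Finset.prod_insert (by decide), Finset.prod_insert (by decide), Finset.prod_insert (by decide),
      Finset.prod_insert (by decide), Finset.prod_singleton]
  have htw : (∑ t : Fin 15, C (cf t * ∏ u' ∈ ({0, 1, 2, 3, 4, 5, 6, 7, 8, 9, 10} : Finset (Fin 15)), ((ex t : ℝ) - ex u')) * X ^ (ex t))
      = C A₁ * X ^ (2 * a) + C A₂ * X ^ (2 * a + 2 * b) + C C₃ * X ^ (2 * a + 2 * b + 2 * c)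
        + C C₄ * X ^ (2 * a + 2 * b + 2 * c + 2 * e) := by
    simp only [hprod]
    simp only [Fin.sum_univ_succ, Fin.sum_univ_zero]
    simp only [hex, hcf, Matrix.cons_val_zero, Matrix.cons_val_succ, Matrix.cons_val_one]
    simp only [hA₁, hA₂, hC₃, hC₄]
    push_cast
    simp only [sub_self, sub_zero, mul_zero, zero_mul, map_zero, zero_add, add_zero, map_mul, map_neg, map_sub, map_add,
      map_pow, map_ofNat]
    ring1
  rw [htw] at step
  have hA₁le : A₁ ≤ 0 := by
    rw [hA₁, neg_nonpos]
    have h1 : (0 : ℝ) ≤ (b : ℝ) - a := by linarith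
    have h2 : (0 : ℝ) ≤ (b : ℝ) + c - a := by linarith
    have h3 : (0 : ℝ) ≤ (b : ℝ) + c + e - a := by linarith
    have h4 : (0 : ℝ) ≤ ((b : ℝ) - a) * (((b : ℝ) + c - a) * ((b : ℝ) + c + e - a)) := mul_nonneg h1 (mul_nonneg h2 h3)
    have h5 : (0 : ℝ) ≤ u₁ ^ 2 * (2 * (a : ℝ) * a) := by positivity
    have h6 : (0 : ℝ) ≤ (b : ℝ) * ((b : ℝ) + c) * ((b : ℝ) + c + e) := by positivity
    have h7 : (0 : ℝ) ≤ (2 * (b : ℝ) + c) * (2 * (b : ℝ) + c + e) * (2 * (b : ℝ) + 2 * c + e) := by positivity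
    exact mul_nonneg (mul_nonneg (mul_nonneg h5 h4) h6) h7
  have hA₂le : A₂ ≤ 0 := by
    rw [hA₂, neg_nonpos]
    have h1 : (0 : ℝ) ≤ (c : ℝ) - a - b := by linarith
    have h2 : (0 : ℝ) ≤ (c : ℝ) + e - a - b := by linarith
    have h3 : (0 : ℝ) ≤ (c : ℝ) - b := by linarith
    have h4 : (0 : ℝ) ≤ (c : ℝ) + e - b := by linarith
    have h5 : (0 : ℝ) ≤ u₂ ^ 2 * ((2 * (a : ℝ) + 2 * b) * ((a : ℝ) + 2 * b) * ((a : ℝ) + b) * b) := by positivity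
    have h6 : (0 : ℝ) ≤ ((c : ℝ) - a - b) * ((c : ℝ) + e - a - b) := mul_nonneg h1 h2
    have h7 : (0 : ℝ) ≤ ((c : ℝ) - b) * ((c : ℝ) + e - b) := mul_nonneg h3 h4
    have h8 : (0 : ℝ) ≤ (c : ℝ) * ((c : ℝ) + e) * (2 * (c : ℝ) + e) := by positivity
    exact mul_nonneg (mul_nonneg (mul_nonneg h5 h6) h7) h8
  have hC₄ge : 0 ≤ C₄ := by rw [hC₄]; positivity
  have hb : 0 < b := lt_of_lt_of_le ha hab
  have hc : 0 < c := lt_of_lt_of_le (Nat.add_pos_left ha b) habc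
  have he : 0 < e := lt_of_lt_of_le (Nat.add_pos_left (Nat.add_pos_left ha b) c) habce
  have top := card_posRoots_le_one_of_signCut4 (2 * a) (2 * b) (2 * c) (2 * e) (by omega) (by omega) (by omega)
    A₁ A₂ C₃ C₄ hA₁le hA₂le hC₄ge
  have e2 : 2 * a + 2 * b + 2 * c + 2 * e = 2 * a + 2 * b + 2 * c + 2 * e := rfl
  omega

end Summit.ValiantsHypothesis.ValiantsHypothesis.Theorems.LacunarySymmetroidMatrixDescartes.Census.SquareLaw
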